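import Mathlib
import Summits.MatrixMultiplication.MatrixMultiplication.Theorems.SnSubsetDichotomyThresholdSubsetTriplesStubCard
import Summits.MatrixMultiplication.MatrixMultiplication.Theorems.SnSubsetDichotomyThresholdSubsetTriplesPairFactorisation

/-!
# `SnSubsetDichotomy.ThresholdSubsetTriples` — stub `stub_pairFactorisation` by COUNTING (injectivity + volume)

Crux `stmt-MatrixMultiplication-10882` (`Theses.SnSubsetDichotomy.ThresholdSubsetTriples`), line
`interleaved-subsignature-ascent`, registered stub `stub_pairFactorisation` (census c3a); siege seat k7 of 24,
variation "reduce to landed lemmas of this crux, then assemble".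

Statement.  For a level set `L ⊆ Fin n` let `S_A = subsig (ownerSystem L)` and `S_B = subsig (ownerSystem Lᶜ)` be
the two complementary OWNER chain classes (full direction set `{d ≤ k}` at the levels `k ∈ L`, resp. `k ∉ L`, and the
identity letter only elsewhere).  Then every `σ : Equiv.Perm (Fin n)` is `s_A⁻¹ * s_B` for EXACTLY ONE pair
`(s_A, s_B) ∈ S_A × S_B`.

Route taken here (different from the simultaneous surjectivity/injectivity induction of the landed
`pairBoth_subsigBelow`): the statement is split into

* VOLUME — `card_subsig_mul_compl : |S_A| · |S_B| = n!`, assembled from the landed exact size formula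
  `stub_card` (p96986, `|subsig D| = ∏ k, |D k|`) and the level count `|D_A k| · |D_B k| = (k+1) · 1`
  (`card_ownerSystem_mul_compl`, from the landed `ownerSystem_of_mem` / `ownerSystem_of_not_mem`), via
  `∏_{k<n} (k+1) = n!`;
* INJECTIVITY — `pair_injOn_subsigBelow`: the pair map `(a, b) ↦ a⁻¹ b` is injective on
  `subsigBelow (ownerSystem L) m × subsigBelow (ownerSystem Lᶜ) m` for every `m ≤ n`, by induction on `m` whose step
  is exactly the landed one-level lemma `pair_step_inj` (p97636; peel the star letter of the class owning level `m`,
  the other class being trivial there, `starPiece_singleton_self`), flipped by `pair_flip_inj` when `A` owns the level;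
* ASSEMBLY — an injective map from a set of `n! = |Equiv.Perm (Fin n)|` pairs into `Equiv.Perm (Fin n)` is onto
  (`Finset.eq_univ_of_card`), which gives existence; uniqueness is the injectivity again.

So surjectivity is never proved by hand: it is read off from the entropy-exactness of chain classes (`stub_card`).
Imports only landed files of this crux (`…ChainDefs` p96122, `…StubCard` p96986, `…PairFactorisation` p97636 for the
vocabulary `ownerSystem`) and Mathlib.  The registered signature is proved verbatim as
`PairCount.stub_pairFactorisation` (sub-namespace: the plain name in `…Theorems.ThresholdSubsetTriples` is taken by the
tree's induction proof, of which this is a deliberate SECOND proof — review note).  NEW relative to that file, as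
reusable Lean facts: the volume identity `card_subsig_mul_compl` (`|S_A||S_B| = n!`, census c3a §1 "in particular",
previously prose only), the level count `card_ownerSystem_mul_compl`, and the bijection in finset form
`pairMap_injOn` / `pairMap_image_eq_univ` (`S_A × S_B → S_n` injective with image `univ`), which is the shape the
design rule "the third class lives in the pair's slack" (census c3a §3, stub `stub_ownerPairNoThird`) consumes.
Elementary; [folklore-type, proved here].
-/

-- `Summit.<Summit>.<Problem>` is the tree's mandated summit-side namespace; for this single-conjunct summit the
-- two components coincide, so the file silences `dupNamespace` (same as the vocabulary files it imports).
set_option linter.dupNamespace false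
set_option autoImplicit false

namespace Summit.MatrixMultiplication.MatrixMultiplication.Theorems.ThresholdSubsetTriples

open scoped Pointwise

namespace PairCount

section Volume

variable {n : ℕ}

/-- The full direction set `{d : d ≤ k}` of level `k` has `k + 1` letters. [folklore] -/
theorem card_filter_le (k : Fin n) : (Finset.univ.filter (fun d : Fin n => d ≤ k)).card = (k : ℕ) + 1 := by
  rw [← Fin.card_Iic k]
  congr 1
  ext d
  simp

/-- Level count of a complementary owner pair: at every level exactly one of the two owner systems carries the
full direction set (`k + 1` letters) and the other the identity letter alone, so `|D_A k| · |D_B k| = k + 1` —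
level pair-efficiency `|D_A k||D_B k|/(k+1) = 1` at every level (census c3a §1). [folklore] -/
theorem card_ownerSystem_mul_compl (L : Finset (Fin n)) (k : Fin n) :
    (ownerSystem L k).card * (ownerSystem Lᶜ k).card = (k : ℕ) + 1 := by
  by_cases hk : k ∈ L
  · have hk' : k ∉ Lᶜ := fun h => (Finset.mem_compl.1 h) hk
    rw [ownerSystem_of_mem hk, ownerSystem_of_not_mem hk', card_filter_le, Finset.card_singleton, mul_one]
  · have hk' : k ∈ Lᶜ := Finset.mem_compl.2 hk
    rw [ownerSystem_of_not_mem hk, ownerSystem_of_mem hk', card_filter_le, Finset.card_singleton, one_mul]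

/-- VOLUME of a complementary owner pair: `|S_A| · |S_B| = n!` — the pair packing bound `|S||T| ≤ n!` is attained
EXACTLY, for every ownership pattern `L` (from the landed exact size formula `stub_card` and the level count).
[folklore] -/
theorem card_subsig_mul_compl (L : Finset (Fin n)) :
    (subsig (ownerSystem L)).card * (subsig (ownerSystem Lᶜ)).card = n.factorial := by
  rw [stub_card _ (ownerSystem_isDirectionSystem L), stub_card _ (ownerSystem_isDirectionSystem Lᶜ),
    ← Finset.prod_mul_distrib]
  simp_rw [card_ownerSystem_mul_compl]
  exact (Fin.prod_univ_eq_prod_range (fun i => i + 1) n).trans (Finset.prod_range_add_one_eq_factorial n)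

end Volume

section Injectivity

variable {n : ℕ}

/-- INJECTIVITY of the pair map `(a, b) ↦ a⁻¹ * b` on the lower owner classes
`subsigBelow (ownerSystem L) m × subsigBelow (ownerSystem Lᶜ) m`, for every `m ≤ n`: induction on `m`, the step
being the landed one-level lemma `pair_step_inj` applied to the class that owns level `m` (the other class has only
the identity letter there), flipped through `pair_flip_inj` when the owner is `A`. [folklore] -/
theorem pair_injOn_subsigBelow (L : Finset (Fin n)) :
    ∀ m : ℕ, m ≤ n →
      ∀ a ∈ subsigBelow (ownerSystem L) m, ∀ a' ∈ subsigBelow (ownerSystem L) m,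
        ∀ b ∈ subsigBelow (ownerSystem Lᶜ) m, ∀ b' ∈ subsigBelow (ownerSystem Lᶜ) m,
          a⁻¹ * b = a'⁻¹ * b' → a = a' ∧ b = b' := by
  intro m
  induction m with
  | zero =>
    intro _ a ha a' ha' b hb b' hb' _
    rw [subsigBelow_zero, Finset.mem_singleton] at ha ha' hb hb'
    subst ha; subst ha'; subst hb; subst hb'
    exact ⟨rfl, rfl⟩
  | succ m ih =>
    intro hm
    have hmn : m < n := Nat.lt_of_succ_le hm
    have ihI := ih hmn.le
    rw [subsigBelow_succ_of_lt _ hmn, subsigBelow_succ_of_lt _ hmn]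
    set t : Fin n := ⟨m, hmn⟩ with ht
    -- the lower classes fix the token `t`
    have fixA : ∀ a ∈ subsigBelow (ownerSystem L) m, a t = t :=
      fun a ha => subsigBelow_apply_of_le _ (ownerSystem_isDirectionSystem L) m a ha t le_rfl
    have fixB : ∀ b ∈ subsigBelow (ownerSystem Lᶜ) m, b t = t :=
      fun b hb => subsigBelow_apply_of_le _ (ownerSystem_isDirectionSystem Lᶜ) m b hb t le_rfl
    by_cases hL : t ∈ L
    · -- `A` owns level `m`: `B` is trivial there; flip, step, flip back
      have hBt : t ∉ Lᶜ := fun h => (Finset.mem_compl.1 h) hL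
      rw [ownerSystem_of_mem hL, ownerSystem_of_not_mem hBt, starPiece_singleton_self,
        Finset.singleton_one, one_mul]
      exact pair_flip_inj _ _
        (pair_step_inj (subsigBelow (ownerSystem Lᶜ) m) (subsigBelow (ownerSystem L) m) t fixB fixA
          (pair_flip_inj _ _ ihI))
    · -- `B` owns level `m`: direct step
      have hBt : t ∈ Lᶜ := Finset.mem_compl.2 hL
      rw [ownerSystem_of_not_mem hL, ownerSystem_of_mem hBt, starPiece_singleton_self,
        Finset.singleton_one, one_mul]
      exact pair_step_inj (subsigBelow (ownerSystem L) m) (subsigBelow (ownerSystem Lᶜ) m) t fixA fixB ihI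

/-- The pair map is injective on `S_A × S_B` (the case `m = n` of `pair_injOn_subsigBelow`), stated as
`Set.InjOn` on the product finset. [folklore] -/
theorem pairMap_injOn (L : Finset (Fin n)) :
    Set.InjOn (fun p : Equiv.Perm (Fin n) × Equiv.Perm (Fin n) => p.1⁻¹ * p.2)
      ↑(subsig (ownerSystem L) ×ˢ subsig (ownerSystem Lᶜ)) := by
  rintro ⟨a, b⟩ hab ⟨a', b'⟩ hab' h
  rw [Finset.coe_product, Set.mem_prod, Finset.mem_coe, Finset.mem_coe] at hab hab'
  obtain ⟨h1, h2⟩ := pair_injOn_subsigBelow L n le_rfl a hab.1 a' hab'.1 b hab.2 b' hab'.2 h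
  rw [h1, h2]

/-- ASSEMBLY by counting: the image of `S_A × S_B` under the (injective) pair map has `n! = |S_n|` elements,
hence is all of `Equiv.Perm (Fin n)`. [folklore] -/
theorem pairMap_image_eq_univ (L : Finset (Fin n)) :
    (subsig (ownerSystem L) ×ˢ subsig (ownerSystem Lᶜ)).image
        (fun p : Equiv.Perm (Fin n) × Equiv.Perm (Fin n) => p.1⁻¹ * p.2) = Finset.univ := by
  apply Finset.eq_univ_of_card
  rw [Finset.card_image_of_injOn (pairMap_injOn L), Finset.card_product, card_subsig_mul_compl,
    Fintype.card_perm, Fintype.card_fin]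

end Injectivity

/-- **Exact pair factorisation (registered stub `stub_pairFactorisation` of crux `stmt-MatrixMultiplication-10882`,
census c3a), counting proof.**  For every level set `L`, every permutation of `Fin n` is `s_A⁻¹ * s_B` for exactly
ONE pair `(s_A, s_B)` of words of the complementary owner chain classes `subsig (ownerSystem L)` and
`subsig (ownerSystem Lᶜ)`: existence because the injective pair map on `n! = |S_n|` pairs is onto
(`pairMap_image_eq_univ`), uniqueness by `pair_injOn_subsigBelow`.  Consequently `|S_A||S_B| = n!` with the pair
map injective — chain PAIRS attain the pair packing bound exactly, so no inequality on pair level data can bound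
chain triples away from threshold (census c3a §2). [folklore-type; proved here] -/
theorem stub_pairFactorisation {n : ℕ} (L : Finset (Fin n)) (σ : Equiv.Perm (Fin n)) :
    ∃! p : Equiv.Perm (Fin n) × Equiv.Perm (Fin n),
      p.1 ∈ subsig (ownerSystem L) ∧ p.2 ∈ subsig (ownerSystem Lᶜ) ∧ p.1⁻¹ * p.2 = σ := by
  have hσ : σ ∈ (subsig (ownerSystem L) ×ˢ subsig (ownerSystem Lᶜ)).image
      (fun p : Equiv.Perm (Fin n) × Equiv.Perm (Fin n) => p.1⁻¹ * p.2) := by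
    rw [pairMap_image_eq_univ L]
    exact Finset.mem_univ σ
  obtain ⟨⟨a, b⟩, hab, rfl⟩ := Finset.mem_image.1 hσ
  rw [Finset.mem_product] at hab
  refine ⟨(a, b), ⟨hab.1, hab.2, rfl⟩, ?_⟩
  rintro ⟨a', b'⟩ ⟨ha', hb', h'⟩
  obtain ⟨h1, h2⟩ := pair_injOn_subsigBelow L n le_rfl a' ha' a hab.1 b' hb' b hab.2 h'
  rw [h1, h2]

end PairCount

end Summit.MatrixMultiplication.MatrixMultiplication.Theorems.ThresholdSubsetTriples
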